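import Mathlib.Order.Filter.AtTopBot.Basic
import Mathlib.Topology.Order.Basic
import Mathlib.MeasureTheory.Integral.Prod
import Mathlib.MeasureTheory.Integral.IntervalIntegral.Basic
import Literature.Analysis.FluidPDE.AnomalousDissipation
import Literature.Analysis.FluidPDE.WeakSolution
import HarnessLib

/-!
# Non-uniqueness and lack of a vanishing-viscosity selection principle for forced Euler on `T³`
  (Bruè–Colombo–Crippa–De Lellis–Sorella 2024, §1.1: Theorems B, C, Corollaries 1.4, 1.5)

Topic `Analysis/FluidPDE`, the §1.1 companion of `AnomalousDissipationOnsagerCritical.lean` (Theorem A)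
and of `AnomalousDissipation.lean` (**turb.S10–S13**; vocabulary `T3`, `R3`,
`Torus.IsClassicalNSSolutionOn`, `eLpHolderNorm`, `MemLpHolder`, `eBoundedHolderNorm`,
`FluidPDE.Torus.IsWeakNSSolutionForcedOn` reused, never redeclared).

E. Bruè, M. Colombo, G. Crippa, C. De Lellis, M. Sorella, *Onsager critical solutions of the forced
Navier–Stokes equations*, Commun. Pure Appl. Anal. 23 (2024) no. 10 = arXiv:2212.08413 (v1, the only
arXiv version, held as `paper:arxiv-2212.08413`); all locators are those of the arXiv v1 PDF
(page-confirmed 2026-08-26): §1.1 "Lack of selection principle and non-uniqueness", admissibility (1.6)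
p. 3, **Theorem B** (Nonuniqueness and lack of selection I) p. 3 with (1.7)–(1.8), **Theorem C**
(Nonuniqueness and lack of selection II) pp. 3–4, **Corollary 1.4**, **Corollary 1.5** (Non uniqueness for
the forced Euler equations I/II) p. 4. "As in [CCS22], a byproduct of our techniques is the lack of a
selection principle under vanishing viscosity for bounded solutions of the three dimensional forced Euler
equations, if the force converges in the vanishing viscosity limit."

## Contents

* `stMeasure T` — plumbing: Lebesgue measure on the space–time slab `(0,T) × T³`
  (`(volume.restrict (Ioo 0 T)).prod volume` on `ℝ × T3`), used to say "distinct" (not a.e. equal) and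
  "weak-* in `L^∞((0,T) × T³)`".
* `Torus.IsForcedAdmissibleOn T F v_in v` — **definition** (1.6): admissibility of a weak solution of
  forced Euler, `∫|v(x,t)|²dx ≤ ∫|v_in|²dx + 2∫₀ᵗ∫ F·v` for a.e. `t ∈ (0,T)`.
* `IsWeakStarLimitPoint T v w` — **definition**: `w` is a limit point of the family `(v ν)_{ν>0}` as
  `ν → 0` in the weak-* topology of `L^∞((0,T) × T³)` (along some `ν_k → 0⁺`, against every
  `φ ∈ L¹((0,T) × T³; ℝ³)`).
* `BCCDS2024_lackOfSelectionI` (Theorem B), `BCCDS2024_lackOfSelectionII` (Theorem C),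
  `BCCDS2024_forcedEulerNonuniquenessI` (Corollary 1.4), `BCCDS2024_forcedEulerNonuniquenessII`
  (Corollary 1.5) — **named facts**, as printed.

## Design choices (faithfulness notes)

* **(1.6) as printed** reads `∫_{T³}|v(x,t)|² dx ≤ ∫_{T³}|v_in(x)|² dx + 2∫_{T³} F(x,t)·v(x,t) dx` for a.e.
  `t ∈ (0,T)`, without a time integral on the work term; the energy balance (1.7) and the strict
  dissipation (1.8) of the same page carry `2∫₀ᵗ∫_{T³} F₀·v`, and the work of the force over `[0,t]` is
  what the energy inequality of an admissible (Leray-type) solution involves. We type (1.6) WITH the time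
  integral `2∫₀ᵗ∫_{T³} F·v dx ds` and record the discrepancy here (a misprint in the source; the typed
  form is the one consistent with (1.7)–(1.8) and with the unforced `Torus.IsAdmissibleWeakEulerOn` of
  `TwoHalfWeakEuler.lean`).
* Theorem B (c) prints `∫_{T²} v_in = 0` — the datum lives on `T³` ((b) of Theorem C and Theorem A print
  `∫_{T³} v_in = 0`); typed as `Torus.HasZeroMean v_in` on `T³`.
* Theorem B (a) requires the forces to satisfy "(1.3)", printed on `[0,1]` while `T = 2` in §1.1; with
  (b) (`F_ν → F₀` in `L^{1+σ}((0,2); C^σ)`) the bound is meant on `[0,2]`, and is typed on `Icc 0 2`.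
* "(unique) smooth solutions of (NS) and (1.1)": classical solutions on `[0,2]` from `v_in`, the velocity
  unique among classical solutions with the same datum (cf. `Torus.IsClassicalNSSolutionOn.velocity_unique`).
* (i) `sup_{ν∈[0,1]} ‖v_ν‖_{L^∞((0,2)×T³)} ≤ 1` is imposed pointwise on `[0,2] × T³` for the smooth `v_ν`,
  `ν ∈ (0,1]`.
* (ii) "at least two distinct limit points, as `ν → 0`, in the `L^∞` weak-* topology, which are two
  distinct bounded admissible solutions of (E) and (1.1)": `IsWeakStarLimitPoint 2 v v^cc`,
  `IsWeakStarLimitPoint 2 v v^ds`, `v^cc ≠ v^ds` as elements of `L^∞` (not `stMeasure 2`-a.e. equal),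
  each a bounded (pointwise, on the representative) weak solution of forced Euler with force `F₀` and
  datum `v_in` on `(0,2)` (`FluidPDE.Torus.IsWeakNSSolutionForcedOn 2 0 F₀ v_in ·`, pressure-free) that is
  admissible in the sense (1.6).
* (iii) The energy identities use Bochner integrals `∫ x, ‖w t x‖²` and the interval integral
  `∫ s in 0..t, ∫ x, ⟪F₀ s x, w s x⟫` (junk `0` on non-integrable slices; for the bounded measurable
  witnesses and `F₀ ∈ L^{1+σ}_t C^σ_x ⊂ L¹_t L^∞_x` of the source they are honest integrals). (1.8) is
  required for EVERY `t ∈ [1,2)`, as printed (a statement about the chosen representative). The datum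
  energy is parenthesised, `(∫ x, ‖v_in x‖ ^ 2) + 2 * ∫ …`, in (1.6)–(1.7), so that the right-hand side is
  the printed sum of two integrals unconditionally (an unparenthesised `∫ x, a x + c` parses as the single
  integral `∫ x, (a x + c)`, which agrees with `(∫ x, a x) + c` on the probability space `T³` only when `a`
  is integrable; referee finding N-LIT-1, 2026-08-26).
* The standing convention of the source makes the body forces divergence-free ((NS) set-up, p. 1); the
  facts below do not record `div F_ν = 0` / `div F₀ = 0` (a weakening only: every printed witness
  satisfies it, and no clause typed here depends on it; referee finding N-LIT-2, 2026-08-26).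
* Theorem C (a): `F_ν → F₀` in `C^{α'}((0,2) × T³)` is convergence in the `C^{0,α'}` norm
  (`eBoundedHolderNorm α'`, sup norm plus Hölder seminorm for the product sup metric on `ℝ × T3`) of the
  restrictions to the slab `(0,2) × T³`; for `α' = 0` this is uniform convergence, and `F₀` is then
  continuous as a uniform limit of smooth fields (recorded explicitly in Corollary 1.5, where no
  approximating family is part of the statement).
* NOT vendored: Remark 1.3 (convex-integration non-uniqueness in `C^β`, `β < 1/3`, for unforced Euler —
  in the tree: `onsager_flexibility`), **Open Question 2** (p. 4: lack of selection with a `ν`-independent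
  force in `L¹((0,2); L^∞(T³))` and Leray solutions) — open, hence not Literature.

## References

* E. Bruè, M. Colombo, G. Crippa, C. De Lellis, M. Sorella, Commun. Pure Appl. Anal. 23 (2024) no. 10,
  arXiv:2212.08413v1, §1.1 pp. 3–4: (1.6), Theorem B with (1.7)–(1.8), Theorem C, Corollaries 1.4–1.5,
  Open Question 2. [`BCCDS2024`]
* M. Colombo, G. Crippa, M. Sorella, *Anomalous dissipation and lack of selection in the Obukhov–Corrsin
  theory of scalar turbulence*, Ann. PDE 9 (2023) (arXiv:2207.06833) — the "[CCS22]" of the source.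
-/

open MeasureTheory Set Filter Topology
open scoped NNReal ENNReal InnerProductSpace

noncomputable section

namespace Literature.Analysis.FluidPDE

section BCCDSSelection

/-! ## Plumbing: the space–time slab measure, forced admissibility, weak-* limit points -/

/-- Lebesgue measure on the space–time slab `(0,T) × T³`, as a measure on `ℝ × T3`: the product of
`volume` restricted to `(0,T)` with the Haar probability measure of `T3`. Plumbing for "a.e. on
`(0,T) × T³`" and for pairings `∫∫ ⟪v, φ⟫`. [folklore] -/
def stMeasure (T : ℝ) : Measure (ℝ × T3) :=
  (volume.restrict (Ioo 0 T)).prod volume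

/-- **Admissible weak solutions of forced Euler** (Bruè–Colombo–Crippa–De Lellis–Sorella,
arXiv:2212.08413v1, (1.6) p. 3): a weak solution `v ∈ L^∞((0,T); L²(T³))` of the forced Euler equations
with force `F` and datum `v_in` is *admissible* if
`∫_{T³} |v(x,t)|² dx ≤ ∫_{T³} |v_in(x)|² dx + 2 ∫₀ᵗ ∫_{T³} F(x,s)·v(x,s) dx ds` for a.e. `t ∈ (0,T)`.
(The source prints the work term without the time integral, `2∫_{T³} F(x,t)·v(x,t) dx`; the time-integrated
form typed here is the one of its (1.7)–(1.8), see the module docstring.) Only the inequality is recorded;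
the weak-solution property is asserted separately (`FluidPDE.Torus.IsWeakNSSolutionForcedOn T 0 F v_in v`).
Bochner integrals (junk `0` on non-integrable slices). Unforced twin: `Torus.IsAdmissibleWeakEulerOn`
(`TwoHalfWeakEuler.lean`). [cite: BCCDS2024, (1.6) p. 3] -/
def Torus.IsForcedAdmissibleOn (T : ℝ) (F : ℝ → T3 → R3) (v_in : T3 → R3) (v : ℝ → T3 → R3) : Prop :=
  ∀ᵐ t ∂(volume.restrict (Ioo 0 T)),
    ∫ x, ‖v t x‖ ^ 2 ≤ (∫ x, ‖v_in x‖ ^ 2) + 2 * ∫ s in (0 : ℝ)..t, ∫ x, ⟪F s x, v s x⟫_ℝ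

/-- **Weak-* limit point of a vanishing-viscosity family.** `w` is a limit point, as `ν → 0`, of the
family `(v ν)_{ν>0}` in the weak-* topology of `L^∞((0,T) × T³)` (the dual of `L¹`): along some sequence
`ν_k > 0`, `ν_k → 0`, `∫∫_{(0,T)×T³} ⟪v_{ν_k}, φ⟫ → ∫∫_{(0,T)×T³} ⟪w, φ⟫` for every
`φ ∈ L¹((0,T) × T³; ℝ³)` (Bruè–Colombo–Crippa–De Lellis–Sorella, arXiv:2212.08413v1, Theorem B (ii) p. 3:
"limit points, as `ν → 0`, in the `L^∞` weak* topology"). [cite: BCCDS2024, Thm. B (ii) p. 3] -/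
def IsWeakStarLimitPoint (T : ℝ) (v : ℝ → ℝ → T3 → R3) (w : ℝ → T3 → R3) : Prop :=
  ∃ νs : ℕ → ℝ, (∀ k, 0 < νs k) ∧ Tendsto νs atTop (𝓝 0) ∧
    ∀ φ : ℝ × T3 → R3, Integrable φ (stMeasure T) →
      Tendsto (fun k => ∫ z, ⟪Function.uncurry (v (νs k)) z, φ z⟫_ℝ ∂(stMeasure T)) atTop
        (𝓝 (∫ z, ⟪Function.uncurry w z, φ z⟫_ℝ ∂(stMeasure T)))

/-! ## Theorem B -/

/-- **Bruè–Colombo–Crippa–De Lellis–Sorella, Theorem B (Nonuniqueness and lack of selection I)**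
(arXiv:2212.08413v1 p. 3), verbatim: "Let `T = 2` and let `α' ∈ [0,1)` be given. Then there are:
(a) `σ > 0` and a family of smooth body forces `F_ν` satisfying (1.3)
[`sup_ν ‖F_ν‖_{L^{1+σ}_t C^σ_x} < ∞`], (b) a limit `F₀` such that `F_ν → F₀` in `L^{1+σ}((0,2); C^σ(T³))`,
(c) a divergence-free initial datum `v_in ∈ C^∞(T³)` with `∫ v_in = 0`, (d) and a family `{v_ν}_{ν>0}`
of (unique) smooth solutions of (NS) and (1.1) such that the following holds:
(i) `sup_{ν∈[0,1]} ‖v_ν‖_{L^∞((0,2)×T³)} ≤ 1`; (ii) `{v_ν}_{ν>0}` has at least two distinct limit points,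
as `ν → 0`, in the `L^∞` weak* topology, which are two distinct bounded admissible solutions `v₀^cs` and
`v₀^ds` of (E) and (1.1); (iii) furthermore, `v₀^cs ∈ L¹((0,2); C^{α'}(T³)) ∩ L^∞` satisfies the following
energy balance `‖v₀^cs(t,·)‖²_{L²} = ‖v_in‖²_{L²} + 2∫₀ᵗ∫_{T³} F₀·v₀^cs` for a.e. `t ∈ (0,2)`, (1.7)
while `v₀^ds ∈ L^∞` exhibits the strict dissipation
`‖v₀^ds(t,·)‖²_{L²} < ‖v_in‖²_{L²}/2 + 2∫₀ᵗ∫_{T³} F₀·v₀^ds` for any `t ∈ [1,2)`. (1.8)"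
Rendering: `α' σ : ℝ≥0`, family indexed by the real `ν > 0`, (1.3) on `[0,2]`, conventions as in the
module docstring (`Torus.IsForcedAdmissibleOn`, `IsWeakStarLimitPoint`, `stMeasure`).
[cite: BCCDS2024, Thm. B p. 3 (arXiv:2212.08413v1); (1.7)–(1.8)] -/
def BCCDS2024_lackOfSelectionI : Prop :=
  ∀ (α' : ℝ≥0), α' < 1 →
    ∃ (σ : ℝ≥0) (v_in : T3 → R3) (F v : ℝ → ℝ → T3 → R3) (p : ℝ → ℝ → T3 → ℝ)
      (F₀ vcs vds : ℝ → T3 → R3),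
      0 < σ ∧
      -- (a) smooth forces on `[0,2] × T³`, uniformly bounded in `L^{1+σ}([0,2]; C^σ)`
      (∀ ν : ℝ, 0 < ν → FunctionSpaces.Torus.IsSmoothSpaceTimeOn (Icc 0 2) (F ν)) ∧
      (∃ C : ℝ≥0∞, C < ∞ ∧
        ∀ ν : ℝ, 0 < ν → FunctionSpaces.eLpHolderNorm (1 + (σ : ℝ≥0∞)) σ (F ν) (Icc 0 2) ≤ C) ∧
      -- (b) `F_ν → F₀` in `L^{1+σ}((0,2); C^σ)`
      FunctionSpaces.MemLpHolder (1 + (σ : ℝ≥0∞)) σ F₀ (Icc 0 2) ∧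
      Tendsto (fun ν => FunctionSpaces.eLpHolderNorm (1 + (σ : ℝ≥0∞)) σ (fun t => F ν t - F₀ t) (Icc 0 2))
        (𝓝[>] 0) (𝓝 0) ∧
      -- (c) the datum
      FunctionSpaces.Torus.IsSmooth v_in ∧ FunctionSpaces.Torus.IsDivFree v_in ∧
        FunctionSpaces.Torus.HasZeroMean v_in ∧
      -- (d) unique classical solutions on `[0,2]` from `v_in`
      (∀ ν : ℝ, 0 < ν →
        FunctionSpaces.Torus.IsClassicalNSSolutionOn (Icc 0 2) ν (F ν) (v ν) (p ν) ∧ v ν 0 = v_in ∧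
        ∀ (w : ℝ → T3 → R3) (q : ℝ → T3 → ℝ),
          FunctionSpaces.Torus.IsClassicalNSSolutionOn (Icc 0 2) ν (F ν) w q → w 0 = v_in →
            ∀ t ∈ Icc (0 : ℝ) 2, w t = v ν t) ∧
      -- (i) `sup_{ν∈[0,1]} ‖v_ν‖_{L^∞((0,2)×T³)} ≤ 1`
      (∀ ν : ℝ, 0 < ν → ν ≤ 1 → ∀ t ∈ Icc (0 : ℝ) 2, ∀ x, ‖v ν t x‖ ≤ 1) ∧
      -- (ii) two distinct weak-* limit points, bounded admissible weak solutions of (E)+(1.1)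
      IsWeakStarLimitPoint 2 v vcs ∧ IsWeakStarLimitPoint 2 v vds ∧
      ¬ (Function.uncurry vcs =ᵐ[stMeasure 2] Function.uncurry vds) ∧
      (FluidPDE.Torus.IsWeakNSSolutionForcedOn 2 0 F₀ v_in vcs ∧ (∃ M : ℝ, ∀ t x, ‖vcs t x‖ ≤ M) ∧
        Torus.IsForcedAdmissibleOn 2 F₀ v_in vcs) ∧
      (FluidPDE.Torus.IsWeakNSSolutionForcedOn 2 0 F₀ v_in vds ∧ (∃ M : ℝ, ∀ t x, ‖vds t x‖ ≤ M) ∧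
        Torus.IsForcedAdmissibleOn 2 F₀ v_in vds) ∧
      -- (iii) regularity and energy balance (1.7) of `v^cs`; strict dissipation (1.8) of `v^ds`
      FunctionSpaces.MemLpHolder 1 α' vcs (Icc 0 2) ∧
      (∀ᵐ t ∂(volume.restrict (Ioo (0 : ℝ) 2)),
        ∫ x, ‖vcs t x‖ ^ 2 = (∫ x, ‖v_in x‖ ^ 2) + 2 * ∫ s in (0 : ℝ)..t, ∫ x, ⟪F₀ s x, vcs s x⟫_ℝ) ∧
      (∀ t ∈ Ico (1 : ℝ) 2,
        ∫ x, ‖vds t x‖ ^ 2 < (∫ x, ‖v_in x‖ ^ 2) / 2 + 2 * ∫ s in (0 : ℝ)..t, ∫ x, ⟪F₀ s x, vds s x⟫_ℝ)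

/-! ## Theorem C -/

/-- **Bruè–Colombo–Crippa–De Lellis–Sorella, Theorem C (Nonuniqueness and lack of selection II)**
(arXiv:2212.08413v1 pp. 3–4), verbatim: "If we give up the regularity of the conservative solution
`v₀^cs` it is possible to show nonuniqueness and lack of selection for much smoother forces. … Let `T = 2`
and let `α' ∈ [0,1)` be given. Then there are: (a) a family `{F_ν}_{ν>0}` of smooth forces and a limiting
`F₀` such that `F_ν → F₀` in `C^{α'}((0,2) × T³)`, (b) a divergence-free initial datum `v_in ∈ C^∞(T³)`
with `∫_{T³} v_in = 0`, (c) and a family `{v_ν}_{ν>0}` of (unique) smooth solutions of (NS) and (1.1),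
such that the following holds: (i) `sup_{ν∈[0,1]} ‖v_ν‖_{L^∞((0,2)×T³)} ≤ 1`; (ii) `{v_ν}` has at least two
distinct limit points, as `ν → 0`, in the `L^∞` weak* topology, which are two distinct bounded admissible
solutions `v₀^cs` and `v₀^ds` of (E) and (1.1); (iii) `v₀^cs` satisfies (1.7) while `v₀^ds` satisfies
(1.8)." Rendering: the `C^{α'}((0,2) × T³)` convergence is in the `C^{0,α'}` norm (`eBoundedHolderNorm α'`,
product sup metric on `ℝ × T3`) of the restrictions to the slab `(0,2) × T³`; otherwise as in
`BCCDS2024_lackOfSelectionI`. [cite: BCCDS2024, Thm. C pp. 3–4 (arXiv:2212.08413v1)] -/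
def BCCDS2024_lackOfSelectionII : Prop :=
  ∀ (α' : ℝ≥0), α' < 1 →
    ∃ (v_in : T3 → R3) (F v : ℝ → ℝ → T3 → R3) (p : ℝ → ℝ → T3 → ℝ) (F₀ vcs vds : ℝ → T3 → R3),
      -- (a) smooth forces with `F_ν → F₀` in `C^{α'}((0,2) × T³)`
      (∀ ν : ℝ, 0 < ν → FunctionSpaces.Torus.IsSmoothSpaceTimeOn (Icc 0 2) (F ν)) ∧
      FunctionSpaces.MemBoundedHolder α'
        (fun z : ↥(Ioo (0 : ℝ) 2 ×ˢ (univ : Set T3)) => F₀ z.1.1 z.1.2) ∧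
      Tendsto (fun ν => FunctionSpaces.eBoundedHolderNorm α'
          (fun z : ↥(Ioo (0 : ℝ) 2 ×ˢ (univ : Set T3)) => F ν z.1.1 z.1.2 - F₀ z.1.1 z.1.2))
        (𝓝[>] 0) (𝓝 0) ∧
      -- (b) the datum
      FunctionSpaces.Torus.IsSmooth v_in ∧ FunctionSpaces.Torus.IsDivFree v_in ∧
        FunctionSpaces.Torus.HasZeroMean v_in ∧
      -- (c) unique classical solutions on `[0,2]` from `v_in`
      (∀ ν : ℝ, 0 < ν →
        FunctionSpaces.Torus.IsClassicalNSSolutionOn (Icc 0 2) ν (F ν) (v ν) (p ν) ∧ v ν 0 = v_in ∧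
        ∀ (w : ℝ → T3 → R3) (q : ℝ → T3 → ℝ),
          FunctionSpaces.Torus.IsClassicalNSSolutionOn (Icc 0 2) ν (F ν) w q → w 0 = v_in →
            ∀ t ∈ Icc (0 : ℝ) 2, w t = v ν t) ∧
      -- (i)
      (∀ ν : ℝ, 0 < ν → ν ≤ 1 → ∀ t ∈ Icc (0 : ℝ) 2, ∀ x, ‖v ν t x‖ ≤ 1) ∧
      -- (ii)
      IsWeakStarLimitPoint 2 v vcs ∧ IsWeakStarLimitPoint 2 v vds ∧
      ¬ (Function.uncurry vcs =ᵐ[stMeasure 2] Function.uncurry vds) ∧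
      (FluidPDE.Torus.IsWeakNSSolutionForcedOn 2 0 F₀ v_in vcs ∧ (∃ M : ℝ, ∀ t x, ‖vcs t x‖ ≤ M) ∧
        Torus.IsForcedAdmissibleOn 2 F₀ v_in vcs) ∧
      (FluidPDE.Torus.IsWeakNSSolutionForcedOn 2 0 F₀ v_in vds ∧ (∃ M : ℝ, ∀ t x, ‖vds t x‖ ≤ M) ∧
        Torus.IsForcedAdmissibleOn 2 F₀ v_in vds) ∧
      -- (iii) (1.7) for `v^cs`, (1.8) for `v^ds`
      (∀ᵐ t ∂(volume.restrict (Ioo (0 : ℝ) 2)),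
        ∫ x, ‖vcs t x‖ ^ 2 = (∫ x, ‖v_in x‖ ^ 2) + 2 * ∫ s in (0 : ℝ)..t, ∫ x, ⟪F₀ s x, vcs s x⟫_ℝ) ∧
      (∀ t ∈ Ico (1 : ℝ) 2,
        ∫ x, ‖vds t x‖ ^ 2 < (∫ x, ‖v_in x‖ ^ 2) / 2 + 2 * ∫ s in (0 : ℝ)..t, ∫ x, ⟪F₀ s x, vds s x⟫_ℝ)

/-! ## Corollaries 1.4 and 1.5 -/

/-- **Bruè–Colombo–Crippa–De Lellis–Sorella, Corollary 1.4 (Non uniqueness for the forced Euler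
equations I)** (arXiv:2212.08413v1 p. 4), verbatim: "Let `α' ∈ [0,1)` be given. There exist `σ > 0`, a
body force `F₀ ∈ L^{1+σ}((0,2); C^σ(T³))` and a divergence-free initial datum `v_in ∈ C^∞(T³)` such that
the `3d` forced Euler equations (E)-(1.1) admit at least two distinct admissible bounded solutions.
Furthermore, one of which belongs [to] `L¹((0,2); C^{α'}(T³))`." Rendering: weak (pressure-free) solutions
of forced Euler with datum on `(0,2)` (`FluidPDE.Torus.IsWeakNSSolutionForcedOn 2 0 F₀ v_in ·`), bounded
pointwise, admissible in the sense (1.6) (`Torus.IsForcedAdmissibleOn`), distinct = not a.e. equal on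
`(0,2) × T³`. [cite: BCCDS2024, Cor. 1.4 p. 4 (arXiv:2212.08413v1)] -/
def BCCDS2024_forcedEulerNonuniquenessI : Prop :=
  ∀ (α' : ℝ≥0), α' < 1 →
    ∃ (σ : ℝ≥0) (F₀ : ℝ → T3 → R3) (v_in : T3 → R3) (w₁ w₂ : ℝ → T3 → R3),
      0 < σ ∧ FunctionSpaces.MemLpHolder (1 + (σ : ℝ≥0∞)) σ F₀ (Icc 0 2) ∧
      FunctionSpaces.Torus.IsSmooth v_in ∧ FunctionSpaces.Torus.IsDivFree v_in ∧
      (FluidPDE.Torus.IsWeakNSSolutionForcedOn 2 0 F₀ v_in w₁ ∧ (∃ M : ℝ, ∀ t x, ‖w₁ t x‖ ≤ M) ∧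
        Torus.IsForcedAdmissibleOn 2 F₀ v_in w₁) ∧
      (FluidPDE.Torus.IsWeakNSSolutionForcedOn 2 0 F₀ v_in w₂ ∧ (∃ M : ℝ, ∀ t x, ‖w₂ t x‖ ≤ M) ∧
        Torus.IsForcedAdmissibleOn 2 F₀ v_in w₂) ∧
      ¬ (Function.uncurry w₁ =ᵐ[stMeasure 2] Function.uncurry w₂) ∧
      FunctionSpaces.MemLpHolder 1 α' w₁ (Icc 0 2)

/-- **Bruè–Colombo–Crippa–De Lellis–Sorella, Corollary 1.5 (Non uniqueness for the forced Euler
equations II)** (arXiv:2212.08413v1 p. 4), verbatim: "Let `α' ∈ [0,1)` be given. There exist a body force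
`F₀ ∈ C^{α'}((0,2) × T³)` and a divergence-free initial datum `v_in ∈ C^∞(T³)` such that the `3d` forced
Euler equations (E)-(1.1) admit at least two distinct admissible bounded solutions." Rendering:
`F₀ ∈ C^{α'}((0,2) × T³)` is continuity on the slab together with a finite `C^{0,α'}` norm of the
restriction (`MemBoundedHolder α'`, product sup metric on `ℝ × T3`; for `α' = 0` just bounded continuous);
solutions as in `BCCDS2024_forcedEulerNonuniquenessI`. [cite: BCCDS2024, Cor. 1.5 p. 4 (arXiv:2212.08413v1)] -/
def BCCDS2024_forcedEulerNonuniquenessII : Prop :=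
  ∀ (α' : ℝ≥0), α' < 1 →
    ∃ (F₀ : ℝ → T3 → R3) (v_in : T3 → R3) (w₁ w₂ : ℝ → T3 → R3),
      ContinuousOn (Function.uncurry F₀) (Ioo (0 : ℝ) 2 ×ˢ (univ : Set T3)) ∧
      FunctionSpaces.MemBoundedHolder α'
        (fun z : ↥(Ioo (0 : ℝ) 2 ×ˢ (univ : Set T3)) => F₀ z.1.1 z.1.2) ∧
      FunctionSpaces.Torus.IsSmooth v_in ∧ FunctionSpaces.Torus.IsDivFree v_in ∧
      (FluidPDE.Torus.IsWeakNSSolutionForcedOn 2 0 F₀ v_in w₁ ∧ (∃ M : ℝ, ∀ t x, ‖w₁ t x‖ ≤ M) ∧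
        Torus.IsForcedAdmissibleOn 2 F₀ v_in w₁) ∧
      (FluidPDE.Torus.IsWeakNSSolutionForcedOn 2 0 F₀ v_in w₂ ∧ (∃ M : ℝ, ∀ t x, ‖w₂ t x‖ ≤ M) ∧
        Torus.IsForcedAdmissibleOn 2 F₀ v_in w₂) ∧
      ¬ (Function.uncurry w₁ =ᵐ[stMeasure 2] Function.uncurry w₂)

end BCCDSSelection

end Literature.Analysis.FluidPDE

end
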